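import Summits.ValiantsHypothesis.ValiantsHypothesis.Theorems.SymPencilSdcPerFourNineteen
import Summits.ValiantsHypothesis.ValiantsHypothesis.Theorems.SymPencilSdcPerThreeWindow

/-!
# Route `SymPencil` — calibration window for the symmetric determinantal complexity of `per₄`:
# `19 ≤ sdc(per₄) ≤ 306`

CALIBRATION WINDOW in the tree's `symmDeterminantalComplexity` vocabulary (support of
stmt-ValiantsHypothesis-5674 `SdcSuperquadratic` through its `n = 4` data point; decides nothing
about the crux, which is asymptotic).  Lower bound: `SymPencilSdcPerFourNineteen`
(`19 ≤ m` for every symmetric affine determinantal representation of `per₄` in characteristic `0`),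
applied to an optimal symmetric representation, which exists by Quarez; upper bound: Quarez's
universal `2·C(n² + ⌊n/2⌋, ⌊n/2⌋) = 2·C(18, 2) = 306` (`SymPencilSdcPerThreeWindow.sdc_perPoly_le_quarez`).

* `sdc_perPoly_four_le` : `sdc(per₄) ≤ 306` (fields with `2 ≠ 0`);
* `sdc_perPoly_four_window` : `19 ≤ sdc(per₄) ≤ 306` (fields of characteristic `0`), and over `ℂ`.

HONEST FRAMING: finite calibration; the exact value in `[19, 306]` is unknown; nothing here bears
on `VP ≠ VNP`. [folklore]
-/

noncomputable section

-- `Summit.<Summit>.<Problem>` repeats `ValiantsHypothesis` by the tree's layout convention (D-0017).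
set_option linter.dupNamespace false

namespace Summit.ValiantsHypothesis.ValiantsHypothesis.Theorems.SymPencilSdcPerFourWindow

open MvPolynomial Literature.Computability.AlgebraicComplexity
open Summit.ValiantsHypothesis.ValiantsHypothesis.Theorems.SymPencilSdcPerThreeWindow
open Summit.ValiantsHypothesis.ValiantsHypothesis.Theorems.SymPencilSdcPerFourNineteen

/-- **`sdc(per₄) ≤ 306`** (`2·C(16 + 2, 2) = 306`, Quarez). [cite: Quarez2012, Thm. 4.1 (1)] -/
theorem sdc_perPoly_four_le (K : Type*) [Field K] (h2 : (2 : K) ≠ 0) :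
    symmDeterminantalComplexity (perPoly (Fin 4) K) ≤ 306 := by
  have h := sdc_perPoly_le_quarez K h2 4
  have h18 : 2 * Nat.choose 18 2 = 306 := by decide
  simpa [h18] using h

/-- **The window `19 ≤ sdc(per₄) ≤ 306`** over any field of characteristic `0`. [folklore] -/
theorem sdc_perPoly_four_window (K : Type*) [Field K] [CharZero K] :
    19 ≤ symmDeterminantalComplexity (perPoly (Fin 4) K) ∧
      symmDeterminantalComplexity (perPoly (Fin 4) K) ≤ 306 := by
  letI : Invertible (2 : K) := invertibleOfNonzero two_ne_zero
  refine ⟨?_, sdc_perPoly_four_le K two_ne_zero⟩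
  obtain ⟨A, hS, hA⟩ :=
    hasSymmDetRepr_symmDeterminantalComplexity ⟨_, hasSymmDetRepr_perPoly_quarez K 4⟩
  exact nineteen_le_of_isSymm_isAffineDetRepr_perPoly_four K hS hA

/-- The complex instance: `19 ≤ sdc(per₄) ≤ 306` over `ℂ`. [folklore] -/
theorem sdc_perPoly_four_window_complex :
    19 ≤ symmDeterminantalComplexity (perPoly (Fin 4) ℂ) ∧
      symmDeterminantalComplexity (perPoly (Fin 4) ℂ) ≤ 306 :=
  sdc_perPoly_four_window ℂ

end Summit.ValiantsHypothesis.ValiantsHypothesis.Theorems.SymPencilSdcPerFourWindow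

end
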